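import Summits.AtomisticToContinuum.HydrodynamicLimit.Theses.JParityClosure
import Literature.Analysis.FluidPDE.CollisionalTransferTimeDep
import Literature.Analysis.FluidPDE.BoltzmannGradLimit
import Literature.Analysis.FunctionSpaces.TorusCalculusProofs
import HarnessLib

/-!
# `JParityClosure.EmpiricalEnskogIdentity` (stmt-AtomisticToContinuum-13086): the microscopic
# Enskog / Bogolyubov identity for empirical measures along one hard-sphere trajectory on `𝕋³`

For a good datum `z` of a hard-sphere flow `Φ` on the flat torus, a `C¹` time weight `a`, a
smooth space test function `b` and an ARBITRARY velocity mark `c`, the tested empirical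
observable `s ↦ a(s) ⟨μ_{Φ_s z}, b ⊗ c⟩ = a(s) N⁻¹ Σ_i b(x_i(s)) c(v_i(s))` changes along the
trajectory by free transport (`∂_s a · ⟨μ, b c⟩ + a ⟨μ, (v·∇b) c⟩`, integrated in time) plus the
collision sum `N⁻¹ Σ_{t_c} a(t_c) Σ_{(i,j) in contact} b(x_i) [c(v_i) − c(v_i⁻)]`, where the
pre-collisional velocity `v_i⁻` is recovered from the post-collisional pair by the (involutive)
reflection law. This is the weak balance law of
`Literature.Analysis.FluidPDE.CollisionalTransferTimeDep`
(`IsHardSphereTrajectory.sub_eq_integral_add_finsum_collisionJump_td`) for the time-dependent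
observable `F s w = a s · N⁻¹ Σ_i b(x_i) c(v_i)`, whose frozen-time jump at a binary collision
of the pair `{i, j}` is computed from the `binary` clause of `IsHardSphereTrajectory` (only the
ordered pairs `(i, j)`, `(j, i)` are in contact; `reflectVel_reflectVel`).

Main results: `empiricalEnskog_identity` (explicit form, `0 ≤ τ`, no positivity of `ε`
needed) and `empiricalEnskogIdentity_proof : JParityClosure.EmpiricalEnskogIdentity` (the route
item verbatim).

References: N. N. Bogolyubov, *Microscopic solutions of the Boltzmann–Enskog equation in
kinetic theory for elastic balls*, Theor. Math. Phys. 24 (1975) [Bogolyubov1975];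
M. Pulvirenti, S. Simonella, A. Trushechkin, *Microscopic solutions of the Boltzmann–Enskog
equation in the series representation*, Kinet. Relat. Models 11 (2018), §2
[PulvirentiSimonellaTrushechkin2018]; H. Spohn, *Large Scale Dynamics of Interacting
Particles* (1991), Part I §3.2 [Spohn1991].
-/

noncomputable section

open MeasureTheory Set Filter Function
open scoped BigOperators Topology Classical InnerProductSpace

namespace Summit.AtomisticToContinuum.HydrodynamicLimit.Theorems

open Literature.Analysis.FluidPDE Literature.Analysis.FunctionSpaces
  Literature.MathematicalPhysics.KineticTheory

/-- After the elastic collision of the pair `(i, j)`, reflecting the post-collisional velocities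
in the (unchanged) separation direction gives back the pre-collisional ones (the reflection law
is an involution, `reflectVel_reflectVel`). [folklore] -/
theorem reflectVel_collidePair_vel {d : Type*} [Fintype d] {X : Type*} {N : ℕ}
    {G : Geometry d X} {i j : Fin N} (hij : i ≠ j) (w : Config N d X) :
    reflectVel (G.sepVec (collidePair G i j w i).1 (collidePair G i j w j).1)
        ((collidePair G i j w i).2, (collidePair G i j w j).2) = ((w i).2, (w j).2) := by
  rw [collidePair_apply_left hij, collidePair_apply_right]
  exact reflectVel_reflectVel _ _

/-- On a hard-sphere trajectory, at a collision time of the pair `{i, j}` the ordered pairs in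
contact are exactly `(i, j)` and `(j, i)` (the `binary` clause: a single pair collides).
[folklore] -/
theorem collisionPair_eq_or_eq_of_mem_contactSet {d : Type*} [Fintype d] {X : Type*}
    [TopologicalSpace X] {N : ℕ} {G : Geometry d X} {ε : ℝ} {γ : ℝ → Config N d X}
    (h : IsHardSphereTrajectory G ε N γ) {t : ℝ} {i j : Fin N} (hij : i ≠ j)
    (hc : γ t ∈ contactSet G N ε i j) {i' j' : Fin N} (hij' : i' ≠ j')
    (hc' : γ t ∈ contactSet G N ε i' j') : i' = i ∧ j' = j ∨ i' = j ∧ j' = i := by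
  have hpair : ({i', j'} : Finset (Fin N)) = {i, j} := (h.binary t i j hij hc).1 i' j' hij' hc'
  rw [← Finset.coe_inj, Finset.coe_pair, Finset.coe_pair, Set.pair_eq_pair_iff] at hpair
  exact hpair

/-- On the flat torus the contact relation is symmetric: `‖sep(x, y)‖ = ‖sep(y, x)‖`
(minimal-image distance, `Torus.euclidDist_comm`). [folklore] -/
theorem mem_contactSet_symm_torus {d : Type*} [Fintype d] {N : ℕ} {ε : ℝ} {i j : Fin N}
    {w : Config N d (UnitAddTorus d)} (hc : w ∈ contactSet (Torus.geometry d) N ε i j) :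
    w ∈ contactSet (Torus.geometry d) N ε j i := by
  refine mem_contactSet.2 ⟨(mem_contactSet.1 hc).1, ?_⟩
  rw [Torus.norm_geometry_sepVec, Torus.euclidDist_comm, ← Torus.norm_geometry_sepVec]
  exact (mem_contactSet.1 hc).2

/-- **The frozen-time jump of the tested empirical observable at a binary collision.** Along a
hard-sphere trajectory `γ` on `𝕋ᵈ`, at a collision time `t` the jump of
`w ↦ r · Σ_k b(x_k) c(v_k)` equals `r` times the double contact sum
`Σ_{i ≠ j, |x_i - x_j| = ε} b(x_i) [c(v_i) − c((reflectVel (x_i − x_j) (v_i, v_j)).1)]` evaluated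
at the post-collisional configuration `γ t`: only the colliding ordered pairs `(i, j)`, `(j, i)`
contribute, positions do not jump, the other particles do not jump, and the reflection of the
outgoing pair is the incoming pair. [folklore] -/
theorem collisionJump_empirical_eq_contact_sum {d : Type*} [Fintype d] {N : ℕ} {ε : ℝ}
    {γ : ℝ → Config N d (UnitAddTorus d)} (h : IsHardSphereTrajectory (Torus.geometry d) ε N γ)
    (r : ℝ) (b : UnitAddTorus d → ℝ) (c : EuclideanSpace ℝ d → ℝ) {t : ℝ}
    (ht : t ∈ collisionTimes (Torus.geometry d) ε γ) :
    collisionJump (fun w : Config N d (UnitAddTorus d) => r * ∑ k, b (w k).1 * c (w k).2) γ t =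
      r * ∑ i : Fin N, ∑ j : Fin N,
        (if i ≠ j ∧ ‖(Torus.geometry d).sepVec (γ t i).1 (γ t j).1‖ = ε then
          b (γ t i).1 * (c (γ t i).2 -
            c (reflectVel ((Torus.geometry d).sepVec (γ t i).1 (γ t j).1)
              ((γ t i).2, (γ t j).2)).1)
        else 0) := by
  have hG : ∀ x : UnitAddTorus d, Continuous ((Torus.geometry d).translate x) := fun x =>
    continuous_const.add Torus.continuous_proj
  obtain ⟨i, j, hij, hc⟩ := mem_collisionTimes.1 ht
  have hcji : γ t ∈ contactSet (Torus.geometry d) N ε j i := mem_contactSet_symm_torus hc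
  have hpos : ∀ k, (leftLim γ t k).1 = (γ t k).1 := h.leftLim_apply_fst hG t
  have hother : ∀ k, k ≠ i → k ≠ j → γ t k = leftLim γ t k := fun k hki hkj =>
    h.apply_eq_leftLim_apply_of_ne hij hc hki hkj
  have hγij : γ t = collidePair (Torus.geometry d) i j (leftLim γ t) :=
    (h.eq_collidePair_leftLim hij hc).2
  have hγji : γ t = collidePair (Torus.geometry d) j i (leftLim γ t) :=
    (h.eq_collidePair_leftLim hij.symm hcji).2
  -- the reflection of the outgoing pair is the incoming pair, in both orders
  have hvi : (reflectVel ((Torus.geometry d).sepVec (γ t i).1 (γ t j).1)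
      ((γ t i).2, (γ t j).2)).1 = (leftLim γ t i).2 := by
    have e := reflectVel_collidePair_vel (G := Torus.geometry d) hij (leftLim γ t)
    rw [← hγij] at e
    rw [e]
  have hvj : (reflectVel ((Torus.geometry d).sepVec (γ t j).1 (γ t i).1)
      ((γ t j).2, (γ t i).2)).1 = (leftLim γ t j).2 := by
    have e := reflectVel_collidePair_vel (G := Torus.geometry d) hij.symm (leftLim γ t)
    rw [← hγji] at e
    rw [e]
  -- left-hand side: only `i` and `j` jump
  have hL : collisionJump (fun w : Config N d (UnitAddTorus d) => r * ∑ k, b (w k).1 * c (w k).2)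
      γ t =
      r * (b (γ t i).1 * (c (γ t i).2 - c (leftLim γ t i).2) +
        b (γ t j).1 * (c (γ t j).2 - c (leftLim γ t j).2)) := by
    simp only [collisionJump, ← mul_sub, ← Finset.sum_sub_distrib, hpos, ← mul_sub]
    congr 1
    rw [Fintype.sum_eq_add i j hij]
    intro k hk
    rw [hother k hk.1 hk.2, hpos, sub_self, mul_zero]
  -- right-hand side: only the ordered pairs `(i, j)` and `(j, i)` are in contact
  have hR : (∑ i' : Fin N, ∑ j' : Fin N,
      (if i' ≠ j' ∧ ‖(Torus.geometry d).sepVec (γ t i').1 (γ t j').1‖ = ε then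
        b (γ t i').1 * (c (γ t i').2 -
          c (reflectVel ((Torus.geometry d).sepVec (γ t i').1 (γ t j').1)
            ((γ t i').2, (γ t j').2)).1)
      else 0)) =
      b (γ t i).1 * (c (γ t i).2 - c (leftLim γ t i).2) +
        b (γ t j).1 * (c (γ t j).2 - c (leftLim γ t j).2) := by
    rw [← Fintype.sum_prod_type', Fintype.sum_eq_add (i, j) (j, i)]
    · rw [if_pos ⟨hij, (mem_contactSet.1 hc).2⟩, if_pos ⟨hij.symm, (mem_contactSet.1 hcji).2⟩,
        hvi, hvj]
    · exact fun hp => hij (Prod.mk.inj hp).1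
    · rintro ⟨i', j'⟩ ⟨hp₁, hp₂⟩
      rw [if_neg]
      rintro ⟨hij', hnorm⟩
      have hc' : γ t ∈ contactSet (Torus.geometry d) N ε i' j' :=
        mem_contactSet.2 ⟨h.mem t, hnorm⟩
      rcases collisionPair_eq_or_eq_of_mem_contactSet h hij hc hij' hc' with
        ⟨rfl, rfl⟩ | ⟨rfl, rfl⟩
      · exact hp₁ rfl
      · exact hp₂ rfl
  rw [hL, hR]

/-- **The microscopic Enskog / Bogolyubov identity for empirical measures** (explicit form of
`JParityClosure.EmpiricalEnskogIdentity`). For a hard-sphere flow `Φ` on `𝕋³`, a good datum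
`z`, `0 ≤ τ`, `a ∈ C¹(ℝ)`, `b` smooth on `𝕋³` and any `c : ℝ³ → ℝ`:
`a(τ)⟨μ_τ, b c⟩ − a(0)⟨μ_0, b c⟩ − ∫_0^τ (a′⟨μ_s, b c⟩ + a ⟨μ_s, (v·∇b) c⟩) ds
  = N⁻¹ Σ_{t_c ∈ (0, τ]} a(t_c) Σ_{i ≠ j in contact} b(x_i) [c(v_i) − c(v_i⁻)]`,
`μ_s` the empirical measure of `Φ_s z` (free transport of `⟨μ_s, b ⊗ c⟩` = collision sum;
Pulvirenti–Simonella–Trushechkin 2018 §2, weak form of Bogolyubov's microscopic Enskog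
equation). Proof: the time-dependent weak balance law
`sub_eq_integral_add_finsum_collisionJump_td` for `F s w = a s · N⁻¹ Σ_i b(x_i) c(v_i)`
(streaming derivative by the torus chain rule), and `collisionJump_empirical_eq_contact_sum`
at each collision time. [cite: PulvirentiSimonellaTrushechkin2018, §2] -/
theorem empiricalEnskog_identity {ε : ℝ} {N : ℕ}
    (Φ : HardSphereFlow (Torus.geometry (Fin 3)) ε N) {z : Config N (Fin 3) T3}
    (hz : z ∈ Φ.good) {τ : ℝ} (hτ : 0 ≤ τ) {a : ℝ → ℝ} (ha : ContDiff ℝ 1 a) {b : T3 → ℝ}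
    (hb : Torus.IsSmooth b) (c : V3 → ℝ) :
    a τ * ∫ q, b q.1 * c q.2 ∂(empiricalMeasure (Φ.flow τ z)) -
        a 0 * ∫ q, b q.1 * c q.2 ∂(empiricalMeasure (Φ.flow 0 z)) -
        ∫ s in Icc (0 : ℝ) τ, (deriv a s * ∫ q, b q.1 * c q.2 ∂(empiricalMeasure (Φ.flow s z)) +
          a s * ∫ q, (∑ k : Fin 3, q.2 k * Torus.partialDeriv k b q.1) * c q.2
            ∂(empiricalMeasure (Φ.flow s z))) =
      (N : ℝ)⁻¹ * ∑ᶠ (s : ℝ) (_ : s ∈ collisionTimes (Torus.geometry (Fin 3)) ε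
        (fun s => Φ.flow s z) ∩ Ioc 0 τ), a s * ∑ i : Fin N, ∑ j : Fin N,
          (if i ≠ j ∧ ‖(Torus.geometry (Fin 3)).sepVec (Φ.flow s z i).1 (Φ.flow s z j).1‖ = ε
            then
            b (Φ.flow s z i).1 * (c (Φ.flow s z i).2 -
              c (reflectVel ((Torus.geometry (Fin 3)).sepVec (Φ.flow s z i).1 (Φ.flow s z j).1)
                ((Φ.flow s z i).2, (Φ.flow s z j).2)).1)
          else 0) := by
  have htraj : IsHardSphereTrajectory (Torus.geometry (Fin 3)) ε N (fun s => Φ.flow s z) :=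
    Φ.isTrajectory z hz
  have hG : ∀ x : T3, Continuous ((Torus.geometry (Fin 3)).translate x) := fun x =>
    continuous_const.add Torus.continuous_proj
  have hb1 : Torus.IsContDiff 1 b := hb.isContDiff (by simp)
  -- the time-dependent observable and its streaming derivative
  set F : ℝ → Config N (Fin 3) T3 → ℝ := fun s w =>
    a s * ((N : ℝ)⁻¹ * ∑ i, b (w i).1 * c (w i).2) with hFdef
  set F' : ℝ → Config N (Fin 3) T3 → ℝ := fun s w =>
    deriv a s * ((N : ℝ)⁻¹ * ∑ i, b (w i).1 * c (w i).2) +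
      a s * ((N : ℝ)⁻¹ *
        ∑ i, (∑ k : Fin 3, (w i).2 k * Torus.partialDeriv k b (w i).1) * c (w i).2)
    with hF'def
  have hF : ∀ (w : Config N (Fin 3) T3) (t₀ t : ℝ),
      HasDerivAt (fun s => F s (freeFlight (Torus.geometry (Fin 3)) (s - t₀) w))
        (F' t (freeFlight (Torus.geometry (Fin 3)) (t - t₀) w)) t := by
    intro w t₀ t
    simp only [hFdef, hF'def, freeFlight_apply, Torus.geometry_translate]
    have hbi : ∀ i : Fin N, HasDerivAt
        (fun s : ℝ => b ((w i).1 + Torus.proj ((s - t₀) • (w i).2)) * c (w i).2)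
        ((∑ k : Fin 3, (w i).2 k *
            Torus.partialDeriv k b ((w i).1 + Torus.proj ((t - t₀) • (w i).2))) * c (w i).2)
        t := by
      intro i
      have h1 := ((Torus.hasDerivAt_apply_add_proj_smul hb1 (w i).1 (w i).2
        (t - t₀)).comp_sub_const t t₀).mul_const (c (w i).2)
      rw [Torus.fderiv_apply_eq_sum_partialDeriv hb1] at h1
      simpa only [smul_eq_mul] using h1
    have hsum := HasDerivAt.fun_sum (u := Finset.univ) fun i _ => hbi i
    exact ((ha.differentiable one_ne_zero) t).hasDerivAt.mul (hsum.const_mul ((N : ℝ)⁻¹))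
  have hF' : ∀ (w : Config N (Fin 3) T3) (t₀ : ℝ),
      Continuous fun t => F' t (freeFlight (Torus.geometry (Fin 3)) (t - t₀) w) := by
    intro w t₀
    simp only [hF'def, freeFlight_apply, Torus.geometry_translate]
    have hda : Continuous (deriv a) := ha.continuous_deriv le_rfl
    have hac : Continuous a := ha.continuous
    have hbc : Continuous b := hb.continuous
    have hpd : ∀ k : Fin 3, Continuous (Torus.partialDeriv k b) := fun k =>
      (hb.partialDeriv k).continuous
    have hflight : ∀ i : Fin N,
        Continuous fun t : ℝ => (w i).1 + Torus.proj ((t - t₀) • (w i).2) := fun i =>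
      continuous_const.add
        (Torus.continuous_proj.comp ((continuous_sub_right t₀).smul continuous_const))
    refine (hda.mul (continuous_const.mul (continuous_finsetSum _ fun i _ =>
      (hbc.comp (hflight i)).mul continuous_const))).add
      (hac.mul (continuous_const.mul (continuous_finsetSum _ fun i _ =>
        (continuous_finsetSum _ fun k _ =>
          continuous_const.mul ((hpd k).comp (hflight i))).mul continuous_const)))
  -- the weak balance law for `F` along the orbit of `z`
  have key := (htraj.sub_eq_integral_add_finsum_collisionJump_td (F := F) (F' := F') hG hF hF'
    hτ).2
  -- the integrals against empirical measures are particle averages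
  simp only [integral_empiricalMeasure]
  rw [integral_Icc_eq_integral_Ioc, ← intervalIntegral.integral_of_le hτ]
  change F τ (Φ.flow τ z) - F 0 (Φ.flow 0 z) - ∫ s in (0 : ℝ)..τ, F' s (Φ.flow s z) = _
  rw [key, add_sub_cancel_left, mul_finsum_mem]
  refine finsum_mem_congr rfl fun s hs => ?_
  -- the jump at a collision time
  have hjump := collisionJump_empirical_eq_contact_sum htraj (a s * (N : ℝ)⁻¹) b c hs.1
  have hFs : F s = fun w : Config N (Fin 3) T3 =>
      a s * (N : ℝ)⁻¹ * ∑ k, b (w k).1 * c (w k).2 := by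
    funext w
    simp only [hFdef, mul_assoc]
  rw [hFs, hjump]
  ring

/-- `JParityClosure.EmpiricalEnskogIdentity` (stmt-AtomisticToContinuum-13086) holds: the exact
Bogolyubov / microscopic-Enskog identity for empirical measures along one hard-sphere
trajectory on `𝕋³` (`empiricalEnskog_identity`; the hypotheses `0 < ε`, `0 < τ` of the item are
not needed beyond `0 ≤ τ`). [cite: PulvirentiSimonellaTrushechkin2018, §2] -/
theorem empiricalEnskogIdentity_proof :
    Summit.AtomisticToContinuum.HydrodynamicLimit.Theses.JParityClosure.EmpiricalEnskogIdentity :=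
  fun _ε _N _hε Φ _z hz _τ hτ _a ha _b hb c => empiricalEnskog_identity Φ hz hτ.le ha hb c

end Summit.AtomisticToContinuum.HydrodynamicLimit.Theorems

end
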